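import Summits.PneNP.PneNP.Theses.KarlinRubin
import Summits.PneNP.PneNP.Theorems.KarlinRubinMonotoneSufficesTransportAverage
import Literature.Computability.Complexity.Rossman2008CliqueProofs
import Literature.Probability.RandomGraphs.ErdosRenyiMass

/-!
# Crux `MonotoneSuffices` (stmt-PneNP-18026), line `slice-transport` — stub `stub_transport`, part 9:
# the two error probabilities of the crux as counting fractions

For a test `f` on the edge vectors of `Kₙ` (`N = C(n,2)` edge slots, `K_A` = the `C(|A|,2)` slots
inside a vertex set `A`):

* `toReal_erdosRenyiHalf_eq` — `Pr_{G(n,1/2)}[f = 1] = #{x | f x} / 2^N` (with the tree's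
  `card_edgeSet_top_fin`, `card_edgeVec`);
* `toReal_plantedCliqueDist_eq` — `Pr_{planted}[f = 0] = #{(A, y) : A ∈ kSubsets, K_A ⊆ supp y, ¬ f y}
  / (#kSubsets · 2^{N - C(min k n, 2)})`: the planted law is uniform on the pairs `(A, y ⊇ K_A)`
  because planting is `2^{#K_A}`-to-one (`sum_plant_eq`, part 5);
* `plant_eq_self_iff` — `plant A y = y ↔ K_A ⊆ supp y` (the skeleton's way of writing the pairs).
-/

set_option linter.dupNamespace false -- `Summit.PneNP.PneNP.…`: summit = sub-problem name (D-0017 single-conjunct layout)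

namespace Summit.PneNP.PneNP.Theorems.MonotoneSuffices.SliceTransport

open Finset Literature.Computability.Complexity Literature.Probability.RandomGraphs.PlantedClique
open scoped ENNReal

/-! ### Cardinalities -/

/-- `K_A` has `C(|A|,2)` slots. [folklore] -/
theorem card_cliqueSlots {n : ℕ} (A : Finset (Fin n)) :
    #(univ.filter fun e : (⊤ : SimpleGraph (Fin n)).edgeSet => ∀ v ∈ (e : Sym2 (Fin n)), v ∈ A) = (#A).choose 2 := by
  classical
  rw [← card_filter_cliqueVec A]
  congr 1
  ext e
  simp [cliqueVec]

/-! ### Planting -/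

/-- `plant A` is the insertion of the slots `K_A`. [folklore] -/
theorem plant_eq_ins {n : ℕ} (A : Finset (Fin n)) (x : EdgeVec n) :
    plant A x = fun e => x e || decide (e ∈ univ.filter fun e : (⊤ : SimpleGraph (Fin n)).edgeSet =>
      ∀ v ∈ (e : Sym2 (Fin n)), v ∈ A) := by
  classical
  funext e
  unfold plant
  congr 1
  rw [Bool.eq_iff_iff]
  simp

/-- `plant A y = y ↔ K_A ⊆ supp y`. [folklore] -/
theorem plant_eq_self_iff {n : ℕ} (A : Finset (Fin n)) (y : EdgeVec n) :
    plant A y = y ↔ (univ.filter fun e : (⊤ : SimpleGraph (Fin n)).edgeSet => ∀ v ∈ (e : Sym2 (Fin n)), v ∈ A) ⊆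
      univ.filter fun e => y e = true := by
  classical
  rw [plant_eq_ins]
  constructor
  · intro h e he
    have := congrFun h e
    rw [mem_filter]
    refine ⟨mem_univ _, ?_⟩
    rw [← this]
    simp only [Bool.or_eq_true, decide_eq_true_eq]
    exact Or.inr he
  · intro h
    funext e
    by_cases he : ∀ v ∈ (e : Sym2 (Fin n)), v ∈ A
    · have hye : y e = true := (mem_filter.1 (h (mem_filter.2 ⟨mem_univ _, he⟩))).2
      simp [hye]
    · simp [he]

/-! ### The two probabilities -/

/-- **Type-I probability as a fraction**: `Pr_{G(n,1/2)}[f = 1] = #{x | f x}/2^{C(n,2)}`. [folklore] -/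
theorem toReal_erdosRenyiHalf_eq {n : ℕ} (f : EdgeVec n → Bool) :
    ((erdosRenyiHalf n).toOuterMeasure {x | f x = true}).toReal =
      (#((univ : Finset (EdgeVec n)).filter fun x => f x = true) : ℝ) / 2 ^ n.choose 2 := by
  classical
  have h : (erdosRenyiHalf n).toOuterMeasure {x | f x = true} =
      (#((univ : Finset (EdgeVec n)).filter fun x => f x = true) : ℝ≥0∞) / ((2 ^ n.choose 2 : ℕ) : ℝ≥0∞) := by
    rw [erdosRenyiHalf, PMF.uniformOfFintype, PMF.toOuterMeasure_uniformOfFinset_apply, card_univ,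
      Literature.Probability.RandomGraphs.card_edgeVec]
    congr 3
    ext x
    simp
  rw [h, ENNReal.toReal_div, ENNReal.toReal_natCast, ENNReal.toReal_natCast]
  push_cast
  norm_num

/-- The planted law of `{f = 0}`, fibred over the planted set. [folklore] -/
theorem plantedCliqueDist_apply_eq_sum {n k : ℕ} (f : EdgeVec n → Bool) :
    (plantedCliqueDist n k).toOuterMeasure {x | f x = false} =
      ∑ A ∈ kSubsets n k, (PMF.uniformOfFinset (kSubsets n k) (kSubsets_nonempty n k)) A *
        (erdosRenyiHalf n).toOuterMeasure {x | f (plant A x) = false} := by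
  classical
  rw [plantedCliqueDist, PMF.toOuterMeasure_map_apply, plantedCliqueJoint, PMF.toOuterMeasure_bind_apply,
    tsum_fintype]
  rw [← sum_subset (subset_univ (kSubsets n k)) (fun A _ hA => by
    rw [PMF.uniformOfFinset_apply_of_notMem (kSubsets_nonempty n k) hA, zero_mul])]
  refine sum_congr rfl fun A _ => ?_
  rw [PMF.toOuterMeasure_map_apply]
  rfl

/-- One fibre as a count: `Pr_{G(n,1/2)}[f (plant A x) = 0] = 2^{C(|A|,2)} · #{y ⊇ K_A | f y = 0} / 2^{C(n,2)}`
for `A ∈ kSubsets n k` (planting is `2^{C(|A|,2)}`-to-one). [folklore] -/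
theorem toReal_fibre_eq {n k : ℕ} (f : EdgeVec n → Bool) {A : Finset (Fin n)} (hA : A ∈ kSubsets n k) :
    ((erdosRenyiHalf n).toOuterMeasure {x | f (plant A x) = false}).toReal =
      (2 : ℝ) ^ (min k n).choose 2 * (#((univ : Finset (EdgeVec n)).filter fun y =>
        (univ.filter fun e : (⊤ : SimpleGraph (Fin n)).edgeSet => ∀ v ∈ (e : Sym2 (Fin n)), v ∈ A) ⊆
          (univ.filter fun e => y e = true) ∧ f y = false) : ℝ) / 2 ^ n.choose 2 := by
  classical
  have hAcard : #A = min k n := card_of_mem_kSubsets hA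
  have hset : {x : EdgeVec n | f (plant A x) = false} = {x | (!f (plant A x)) = true} := by
    ext x; simp
  rw [hset, toReal_erdosRenyiHalf_eq (fun x => !f (plant A x))]
  congr 1
  have hsum := sum_plant_eq (univ.filter fun e : (⊤ : SimpleGraph (Fin n)).edgeSet => ∀ v ∈ (e : Sym2 (Fin n)), v ∈ A)
    (fun y => if f y = false then (1 : ℝ) else 0)
  simp only [sum_boole, filter_filter] at hsum
  rw [card_cliqueSlots A, hAcard] at hsum
  refine Eq.trans ?_ hsum
  exact_mod_cast congrArg Finset.card (Finset.ext fun x => by simp [plant_eq_ins])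

/-- **Type-II probability as a fraction**: the planted law gives `{f = 0}` the mass
`#{(A, y) : A ∈ kSubsets n k, K_A ⊆ supp y, f y = 0} / (#kSubsets · 2^{C(n,2) - C(min k n, 2)})`.
[folklore] -/
theorem toReal_plantedCliqueDist_eq {n k : ℕ} (f : EdgeVec n → Bool) :
    ((plantedCliqueDist n k).toOuterMeasure {x | f x = false}).toReal =
      (#((kSubsets n k ×ˢ (univ : Finset (EdgeVec n))).filter fun p =>
          (univ.filter fun e : (⊤ : SimpleGraph (Fin n)).edgeSet => ∀ v ∈ (e : Sym2 (Fin n)), v ∈ p.1) ⊆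
            (univ.filter fun e => p.2 e = true) ∧ f p.2 = false) : ℝ) /
        ((#(kSubsets n k) : ℝ) * 2 ^ (n.choose 2 - (min k n).choose 2)) := by
  classical
  have hle1 : ∀ s : Set (EdgeVec n), (erdosRenyiHalf n).toOuterMeasure s ≤ 1 := fun s =>
    ((erdosRenyiHalf n).toOuterMeasure.mono (Set.subset_univ s)).trans_eq
      ((PMF.toOuterMeasure_apply_eq_one_iff _ _).2 (Set.subset_univ _))
  rw [plantedCliqueDist_apply_eq_sum, ENNReal.toReal_sum (fun A _ => ENNReal.mul_ne_top (PMF.apply_ne_top _ _)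
    (ne_top_of_le_ne_top ENNReal.one_ne_top (hle1 _)))]
  have hterm : ∀ A ∈ kSubsets n k, ((PMF.uniformOfFinset (kSubsets n k) (kSubsets_nonempty n k)) A *
      (erdosRenyiHalf n).toOuterMeasure {x | f (plant A x) = false}).toReal =
      (1 / #(kSubsets n k)) * ((2 : ℝ) ^ (min k n).choose 2 * (#((univ : Finset (EdgeVec n)).filter fun y =>
        (univ.filter fun e : (⊤ : SimpleGraph (Fin n)).edgeSet => ∀ v ∈ (e : Sym2 (Fin n)), v ∈ A) ⊆
          (univ.filter fun e => y e = true) ∧ f y = false) : ℝ) / 2 ^ n.choose 2) := by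
    intro A hA
    rw [ENNReal.toReal_mul, toReal_fibre_eq f hA, PMF.uniformOfFinset_apply_of_mem (kSubsets_nonempty n k) hA,
      ENNReal.toReal_inv, ENNReal.toReal_natCast, one_div]
  rw [sum_congr rfl hterm, ← mul_sum, ← sum_div, ← mul_sum, card_filter_product_eq_sum]
  have hKle : (min k n).choose 2 ≤ n.choose 2 := Nat.choose_le_choose 2 (min_le_right k n)
  have hpow : (2 : ℝ) ^ n.choose 2 = 2 ^ (min k n).choose 2 * 2 ^ (n.choose 2 - (min k n).choose 2) := by
    rw [← pow_add, Nat.add_sub_cancel' hKle]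
  have hc : (2 : ℝ) ^ (min k n).choose 2 ≠ 0 := pow_ne_zero _ two_ne_zero
  rw [hpow, mul_div_mul_left _ _ hc, one_div, ← div_eq_inv_mul, div_div, mul_comm (_ ^ _ : ℝ)]

/-- **transport_bridge** (registered helper sub-goal of stmt-PneNP-18026 for `stub_transport`,
part 9): the planted rejection probability as a counting fraction over the pairs `(A, y ⊇ K_A)`
(`toReal_plantedCliqueDist_eq`). [folklore] -/
theorem transport_bridge :
    ∀ {n k : ℕ} (f : Literature.Probability.RandomGraphs.PlantedClique.EdgeVec n → Bool), ((Literature.Probability.RandomGraphs.PlantedClique.plantedCliqueDist n k).toOuterMeasure {x | f x = false}).toReal = (#((Literature.Probability.RandomGraphs.PlantedClique.kSubsets n k ×ˢ (Finset.univ : Finset (Literature.Probability.RandomGraphs.PlantedClique.EdgeVec n))).filter fun p => (Finset.univ.filter fun e : (⊤ : SimpleGraph (Fin n)).edgeSet => ∀ v ∈ (e : Sym2 (Fin n)), v ∈ p.1) ⊆ (Finset.univ.filter fun e => p.2 e = true) ∧ f p.2 = false) : ℝ) / ((#(Literature.Probability.RandomGraphs.PlantedClique.kSubsets n k) : ℝ)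 * 2 ^ (n.choose 2 - (min k n).choose 2)) :=
  fun f => toReal_plantedCliqueDist_eq f

end Summit.PneNP.PneNP.Theorems.MonotoneSuffices.SliceTransport
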